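import Mathlib
import Literature.NumberTheory.LFunctions.FeketePolynomial
import Summits.ValiantsHypothesis.ValiantsHypothesis.Theses.FeketeSOS
import Summits.ValiantsHypothesis.ValiantsHypothesis.Theorems.FeketeSOSSublinearShadowThreeSquares
import Summits.ValiantsHypothesis.ValiantsHypothesis.Theorems.FeketeSOSSublinearShadowTwoDeepShadow
import Summits.ValiantsHypothesis.ValiantsHypothesis.Theorems.FeketeSOSSublinearShadowConicParam
import Summits.ValiantsHypothesis.ValiantsHypothesis.Theorems.FeketeSOSSublinearShadowSymmCongruenceDiag
import Summits.ValiantsHypothesis.ValiantsHypothesis.Theorems.FeketeSOSSublinearShadowBinaryQuarticSplit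

/-!
# `FeketeSOS.SublinearShadow` (stmt-ValiantsHypothesis-14990), line `Sketch` — fan-in 3: NO COMPLEX QUADRATIC SYZYGY

If `Σ_{i<3} c_i g_i² = F_p` over `ℂ` with `(Σ|supp g_i|)⁴ ≤ p³`, `p ≥ 257`, then no non-zero symmetric `ν ∈ ℂ^{3×3}` has
`Σ ν_{jj'} g_j g_{j'} = 0` (`syzygyFree_three`); in particular the `g_i` are linearly independent (`linearIndependent_three`).
Proof: diagonalise `ν = Eᵀ·diag(w)·E` (`stub_symmCongruenceDiag`), `z = E·g`, `Σ w_l z_l² = 0`; one or two non-zero weights put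
`span(g)` inside the span of two `U`-supported polynomials (`U = ∪ supp g_i`), making `F_p` a binary quadratic form in them, i.e. a
splitting `F_p = A·B` with `|supp A| + |supp B| ≤ 2|U|` — impossible (`tsq_split_bound`, `tsq_arith`); three give a conic `P·P' = R²`,
`span(g) = D·⟨M², MN, N²⟩` (`stub_conicParam`), `F_p ∈ D²·⟨M⁴,…,N⁴⟩` splits again (`stub_binaryQuarticSplit`).  Hence at `s = 3` the
everywhere-Gram-deep residual consists of spans with no syzygy over `ℂ` but a conic relation modulo every prime over `p`.
-/

namespace Summit.ValiantsHypothesis.ValiantsHypothesis.Theorems.SublinearShadowSketch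

open Polynomial Finset IsLocalRing Matrix
open scoped BigOperators
open Literature.NumberTheory.LFunctions

-- `Summit.ValiantsHypothesis.ValiantsHypothesis.…` is the tree's mandated single-conjunct layout (Sub = Summit).
set_option linter.dupNamespace false

/-- Supports of sums of scaled polynomials stay inside a common bound. -/
theorem sft_support_sum_subset {ι : Type*} (s : Finset ι) (U : Finset ℕ) (f : ι → ℂ[X])
    (hf : ∀ i ∈ s, (f i).support ⊆ U) : (∑ i ∈ s, f i).support ⊆ U := by
  classical
  induction s using Finset.induction_on with
  | empty => simp
  | insert a s ha ih =>
    rw [Finset.sum_insert ha]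
    exact support_add.trans (Finset.union_subset (hf a (Finset.mem_insert_self a s))
      (ih fun i hi => hf i (Finset.mem_insert_of_mem hi)))

/-- `supp (C a · f) ⊆ supp f`. -/
theorem sft_support_C_mul_subset (a : ℂ) (f : ℂ[X]) : (C a * f).support ⊆ f.support :=
  dzs_support_C_mul_subset a f

/-- A sum over `Fin 3` read from any starting index. -/
theorem sft_sum_rotate {M : Type*} [AddCommMonoid M] (f : Fin 3 → M) (m : Fin 3) :
    (∑ l, f l) = f m + f (m + 1) + f (m + 2) := by
  rw [← Equiv.sum_comp (Equiv.addLeft m) f, Fin.sum_univ_three]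
  simp only [Equiv.coe_addLeft, add_zero]

/-- **No two `U`-supported polynomials multiply to `F_p`** when `2|U| ≤ 2S` and `S⁴ ≤ p³`, `p ≥ 257`
(landed two-factor bound `(p+3)/2 ≤ |supp A| + |supp B|`). -/
theorem sft_no_split (p : ℕ) [Fact p.Prime] (hp : 257 ≤ p) (U : Finset ℕ) (S : ℕ) (hUS : U.card ≤ S)
    (hS : S ^ 4 ≤ p ^ 3) (A B : ℂ[X]) (hA : A.support ⊆ U) (hB : B.support ⊆ U)
    (hAB : A * B = ∑ m ∈ Finset.range p, C ((legendreSym p m : ℤ) : ℂ) * X ^ m) : False := by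
  have hp2 : p ≠ 2 := by omega
  have hT := tsq_split_bound p hp2 A B hAB
  refine tsq_arith p S (A.support.card + B.support.card) hp hT ?_ hS
  calc A.support.card + B.support.card ≤ U.card + U.card :=
        Nat.add_le_add (Finset.card_le_card hA) (Finset.card_le_card hB)
    _ ≤ 2 * S := by omega

/-- **No binary quadratic form in two `U`-supported polynomials equals `F_p`**: `G₀₀ y₀² + G₀₁ y₀y₁ + G₁₁ y₁²` is a
product (`G₀₀ = 0`) or, after completing the square, two weighted squares, hence a product on `supp y₀ ∪ supp y₁`. -/
theorem sft_no_binary_qf (p : ℕ) [Fact p.Prime] (hp : 257 ≤ p) (U : Finset ℕ) (S : ℕ) (hUS : U.card ≤ S)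
    (hS : S ^ 4 ≤ p ^ 3) (y₀ y₁ : ℂ[X]) (hy₀ : y₀.support ⊆ U) (hy₁ : y₁.support ⊆ U) (G₀₀ G₀₁ G₁₁ : ℂ)
    (hF : C G₀₀ * y₀ ^ 2 + C G₀₁ * (y₀ * y₁) + C G₁₁ * y₁ ^ 2
      = ∑ m ∈ Finset.range p, C ((legendreSym p m : ℤ) : ℂ) * X ^ m) : False := by
  by_cases h0 : G₀₀ = 0
  · -- a product `y₁ · (G₀₁ y₀ + G₁₁ y₁)`
    refine sft_no_split p hp U S hUS hS y₁ (C G₀₁ * y₀ + C G₁₁ * y₁) hy₁ ?_ ?_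
    · exact support_add.trans (Finset.union_subset ((sft_support_C_mul_subset _ _).trans hy₀)
        ((sft_support_C_mul_subset _ _).trans hy₁))
    · rw [← hF, h0, C_0]; ring
  · -- complete the square: two weighted squares of `y₀ + (G₀₁/(2G₀₀)) y₁` and `y₁`
    set t : ℂ := G₀₁ / (2 * G₀₀) with ht
    have hid : C G₀₀ * y₀ ^ 2 + C G₀₁ * (y₀ * y₁) + C G₁₁ * y₁ ^ 2
        = C G₀₀ * (y₀ + C t * y₁) ^ 2 + C (G₁₁ - G₀₀ * t ^ 2) * y₁ ^ 2 := by
      have h2t : G₀₀ * (2 * t) = G₀₁ := by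
        rw [ht]; field_simp
      have e1 : C G₀₁ = C G₀₀ * C 2 * C t := by rw [← C_mul, ← C_mul, ← h2t]; ring_nf
      rw [e1, C_sub, C_mul, C_pow]
      have e2 : (C (2 : ℂ) : ℂ[X]) = 2 := map_ofNat C 2
      rw [e2]; ring
    obtain ⟨A, B, hAB, hAs, hBs⟩ := tds_split G₀₀ (G₁₁ - G₀₀ * t ^ 2) (y₀ + C t * y₁) y₁
    have hsum : (y₀ + C t * y₁).support ⊆ U :=
      support_add.trans (Finset.union_subset hy₀ ((sft_support_C_mul_subset _ _).trans hy₁))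
    have hU2 : (y₀ + C t * y₁).support ∪ y₁.support ⊆ U := Finset.union_subset hsum hy₁
    exact sft_no_split p hp U S hUS hS A B (hAs.trans hU2) (hBs.trans hU2) (by rw [hAB, ← hid, hF])

/-- **`F_p` is not a quadratic form in two `U`-supported polynomials spanning the `g_i`.** -/
theorem sft_no_two_span (p : ℕ) [Fact p.Prime] (hp : 257 ≤ p) (U : Finset ℕ) (S : ℕ) (hUS : U.card ≤ S)
    (hS : S ^ 4 ≤ p ^ 3) (c : Fin 3 → ℂ) (g : Fin 3 → ℂ[X])
    (hrep : (∑ i, C (c i) * g i ^ 2) = ∑ m ∈ Finset.range p, C ((legendreSym p m : ℤ) : ℂ) * X ^ m)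
    (y₀ y₁ : ℂ[X]) (hy₀ : y₀.support ⊆ U) (hy₁ : y₁.support ⊆ U)
    (α β : Fin 3 → ℂ) (hg : ∀ j, g j = C (α j) * y₀ + C (β j) * y₁) : False := by
  refine sft_no_binary_qf p hp U S hUS hS y₀ y₁ hy₀ hy₁ (∑ i, c i * α i ^ 2) (∑ i, c i * (2 * α i * β i))
    (∑ i, c i * β i ^ 2) ?_
  rw [← hrep]
  simp only [map_sum, Finset.sum_mul, ← Finset.sum_add_distrib]
  refine Finset.sum_congr rfl fun i _ => ?_
  rw [hg i]
  simp only [C_mul, map_ofNat, C_pow]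
  ring

/-- Solving `C a · x = C b · y` for `x` when `a ≠ 0`. -/
theorem sft_solve {a b : ℂ} (ha : a ≠ 0) {x y : ℂ[X]} (h : C a * x = C b * y) : x = C (b / a) * y := by
  have hCa : (C a : ℂ[X]) ≠ 0 := by rwa [Ne, C_eq_zero]
  apply mul_left_cancel₀ hCa
  rw [h, ← mul_assoc, ← C_mul]
  congr 2
  field_simp

/-- **No complex quadratic syzygy at fan-in 3.**  If `Σ_{i<3} c_i g_i² = F_p` over `ℂ` with `(Σ|supp g_i|)⁴ ≤ p³` and
`p ≥ 257`, then every symmetric `ν ∈ ℂ^{3×3}` with `Σ_{j,j'} ν_{jj'} g_j g_{j'} = 0` vanishes. -/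
theorem syzygyFree_three (p : ℕ) [Fact p.Prime] (hp : 257 ≤ p) (c : Fin 3 → ℂ) (g : Fin 3 → ℂ[X])
    (hS : (∑ i, (g i).support.card) ^ 4 ≤ p ^ 3)
    (hrep : (∑ i, C (c i) * g i ^ 2) = ∑ m ∈ Finset.range p, C ((legendreSym p m : ℤ) : ℂ) * X ^ m)
    (ν : Matrix (Fin 3) (Fin 3) ℂ) (hsym : ν.IsSymm)
    (hν : (∑ j, ∑ j', C (ν j j') * (g j * g j')) = 0) : ν = 0 := by
  classical
  set S : ℕ := ∑ i, (g i).support.card with hSdef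
  set U : Finset ℕ := Finset.univ.biUnion fun i => (g i).support with hU
  have hUS : U.card ≤ S := Finset.card_biUnion_le
  have hgU : ∀ i, (g i).support ⊆ U := fun i =>
    Finset.subset_biUnion_of_mem (fun i => (g i).support) (Finset.mem_univ i)
  have hspanU : ∀ (α : Fin 3 → ℂ), (∑ j, C (α j) * g j).support ⊆ U := fun α =>
    sft_support_sum_subset _ U _ fun j _ => (sft_support_C_mul_subset _ _).trans (hgU j)
  obtain ⟨E, w, hEdet, hνE⟩ := stub_symmCongruenceDiag 3 ν hsym
  set z : Fin 3 → ℂ[X] := fun l => ∑ j, C (E l j) * g j with hz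
  have hzU : ∀ l, (z l).support ⊆ U := fun l => hspanU (E l)
  -- the syzygy in diagonal form: `Σ_l w_l z_l² = 0`
  have hνentry : ∀ j j', ν j j' = ∑ l, E l j * w l * E l j' := fun j j' => by
    rw [hνE, Matrix.mul_apply]
    refine Finset.sum_congr rfl fun l _ => ?_
    rw [Matrix.mul_apply, Finset.sum_eq_single l]
    · simp [Matrix.transpose_apply, Matrix.diagonal_apply_eq]
    · intro l' _ hl'
      simp [Matrix.diagonal_apply_ne _ hl']
    · intro h; exact absurd (Finset.mem_univ l) h
  have hdiag : (∑ l, C (w l) * z l ^ 2) = 0 := by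
    rw [← hν]
    have e1 : ∀ l, C (w l) * z l ^ 2 = ∑ j, ∑ j', C (E l j * w l * E l j') * (g j * g j') := fun l => by
      simp only [hz]
      rw [sq, Finset.sum_mul_sum, Finset.mul_sum]
      refine Finset.sum_congr rfl fun j _ => ?_
      rw [Finset.mul_sum]
      refine Finset.sum_congr rfl fun j' _ => ?_
      simp only [C_mul]; ring
    rw [Finset.sum_congr rfl fun l _ => e1 l, Finset.sum_comm]
    refine Finset.sum_congr rfl fun j _ => ?_
    rw [Finset.sum_comm]
    refine Finset.sum_congr rfl fun j' _ => ?_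
    rw [hνentry j j', map_sum, Finset.sum_mul]
  -- `g` in terms of `z`: `g_j = Σ_l E⁻¹_{jl} z_l`
  have hginv : ∀ j, g j = ∑ l, C (E⁻¹ j l) * z l := fun j => by
    have hEE : E⁻¹ * E = 1 := Matrix.nonsing_inv_mul E hEdet
    have e1 : (∑ l, C (E⁻¹ j l) * z l) = ∑ j', C ((E⁻¹ * E) j j') * g j' := by
      simp only [hz, Finset.mul_sum]
      rw [Finset.sum_comm]
      refine Finset.sum_congr rfl fun j' _ => ?_
      rw [Matrix.mul_apply, map_sum, Finset.sum_mul]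
      refine Finset.sum_congr rfl fun l _ => ?_
      rw [C_mul]; ring
    rw [e1, hEE, Finset.sum_eq_single j]
    · simp
    · intro j' _ hj'
      rw [Matrix.one_apply_ne (Ne.symm hj'), C_0, zero_mul]
    · intro h; exact absurd (Finset.mem_univ j) h
  suffices hw : ∀ l, w l = 0 by
    rw [hνE]
    have : Matrix.diagonal w = 0 := by
      ext l l'
      by_cases h : l = l'
      · subst h; simp [hw l]
      · simp [Matrix.diagonal_apply_ne _ h]
    rw [this, Matrix.mul_zero, Matrix.zero_mul]
  -- KEY REDUCTION: if some `z_m` lies in the span of the other two, `F_p` is a binary form in two `U`-supported polynomials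
  have hred : ∀ (m : Fin 3) (μ₁ μ₂ : ℂ), z m = C μ₁ * z (m + 1) + C μ₂ * z (m + 2) → False := by
    intro m μ₁ μ₂ hzm
    refine sft_no_two_span p hp U S hUS hS c g hrep (z (m + 1)) (z (m + 2)) (hzU _) (hzU _)
      (fun j => E⁻¹ j m * μ₁ + E⁻¹ j (m + 1)) (fun j => E⁻¹ j m * μ₂ + E⁻¹ j (m + 2)) fun j => ?_
    rw [hginv j, sft_sum_rotate _ m, hzm]
    simp only [C_add, C_mul]
    ring
  intro l₀
  by_contra hl₀
  have hrel : C (w l₀) * z l₀ ^ 2 + C (w (l₀ + 1)) * z (l₀ + 1) ^ 2 + C (w (l₀ + 2)) * z (l₀ + 2) ^ 2 = 0 := by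
    rw [← sft_sum_rotate (fun l => C (w l) * z l ^ 2) l₀]; exact hdiag
  by_cases h1 : w (l₀ + 1) = 0
  · by_cases h2 : w (l₀ + 2) = 0
    · -- one non-zero weight: `z_{l₀} = 0`
      rw [h1, h2, C_0, zero_mul, zero_mul, add_zero, add_zero] at hrel
      have hz0 : z l₀ = 0 := by
        have := mul_eq_zero.mp hrel
        rcases this with h | h
        · exact absurd (C_eq_zero.mp h) hl₀
        · exact pow_eq_zero_iff two_ne_zero |>.mp h
      exact hred l₀ 0 0 (by rw [hz0, C_0, zero_mul, zero_mul, add_zero])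
    · -- two non-zero weights `w_{l₀}, w_{l₀+2}`: `z_{l₀+2} ∈ ℂ · z_{l₀}`... read from `m = l₀ + 1`
      rw [h1, C_0, zero_mul, add_zero] at hrel
      obtain ⟨A, B, hAB, -, -⟩ := tds_split (w l₀) (w (l₀ + 2)) (z l₀) (z (l₀ + 2))
      obtain ⟨a, ha⟩ := IsAlgClosed.exists_pow_nat_eq (w l₀) (n := 2) two_pos
      obtain ⟨b, hb⟩ := IsAlgClosed.exists_pow_nat_eq (-w (l₀ + 2)) (n := 2) two_pos
      have ha0 : a ≠ 0 := fun h0 => hl₀ (by rw [← ha, h0]; ring)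
      have hb0 : b ≠ 0 := fun h0 => h2 (by
        have : -w (l₀ + 2) = 0 := by rw [← hb, h0]; ring
        exact neg_eq_zero.mp this)
      have hprod : (C a * z l₀ + C b * z (l₀ + 2)) * (C a * z l₀ - C b * z (l₀ + 2)) = 0 := by
        have e : (C a * z l₀ + C b * z (l₀ + 2)) * (C a * z l₀ - C b * z (l₀ + 2))
            = C (a ^ 2) * z l₀ ^ 2 - C (b ^ 2) * z (l₀ + 2) ^ 2 := by simp only [C_pow]; ring
        rw [e, ha, hb, C_neg]
        rw [← hrel]; ring
      clear hAB A B
      rcases mul_eq_zero.mp hprod with h | h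
      · refine hred l₀ 0 (-b / a) ?_
        have : C a * z l₀ = C (-b) * z (l₀ + 2) := by
          rw [C_neg, neg_mul]; exact eq_neg_of_add_eq_zero_left h
        rw [C_0, zero_mul, zero_add]; exact sft_solve ha0 this
      · refine hred l₀ 0 (b / a) ?_
        have : C a * z l₀ = C b * z (l₀ + 2) := sub_eq_zero.mp h
        rw [C_0, zero_mul, zero_add]; exact sft_solve ha0 this
  · by_cases h2 : w (l₀ + 2) = 0
    · -- two non-zero weights `w_{l₀}, w_{l₀+1}`
      rw [h2, C_0, zero_mul, add_zero] at hrel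
      obtain ⟨a, ha⟩ := IsAlgClosed.exists_pow_nat_eq (w l₀) (n := 2) two_pos
      obtain ⟨b, hb⟩ := IsAlgClosed.exists_pow_nat_eq (-w (l₀ + 1)) (n := 2) two_pos
      have ha0 : a ≠ 0 := fun h0 => hl₀ (by rw [← ha, h0]; ring)
      have hprod : (C a * z l₀ + C b * z (l₀ + 1)) * (C a * z l₀ - C b * z (l₀ + 1)) = 0 := by
        have e : (C a * z l₀ + C b * z (l₀ + 1)) * (C a * z l₀ - C b * z (l₀ + 1))
            = C (a ^ 2) * z l₀ ^ 2 - C (b ^ 2) * z (l₀ + 1) ^ 2 := by simp only [C_pow]; ring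
        rw [e, ha, hb, C_neg]
        rw [← hrel]; ring
      rcases mul_eq_zero.mp hprod with h | h
      · refine hred l₀ (-b / a) 0 ?_
        have : C a * z l₀ = C (-b) * z (l₀ + 1) := by
          rw [C_neg, neg_mul]; exact eq_neg_of_add_eq_zero_left h
        rw [C_0, zero_mul, add_zero]; exact sft_solve ha0 this
      · refine hred l₀ (b / a) 0 ?_
        have : C a * z l₀ = C b * z (l₀ + 1) := sub_eq_zero.mp h
        rw [C_0, zero_mul, add_zero]; exact sft_solve ha0 this
    · -- three non-zero weights: the conic `P · P' = R²`
      obtain ⟨a, ha⟩ := IsAlgClosed.exists_pow_nat_eq (w l₀) (n := 2) two_pos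
      obtain ⟨b, hb⟩ := IsAlgClosed.exists_pow_nat_eq (-w (l₀ + 1)) (n := 2) two_pos
      obtain ⟨e, he⟩ := IsAlgClosed.exists_pow_nat_eq (-w (l₀ + 2)) (n := 2) two_pos
      have ha0 : a ≠ 0 := fun h0 => hl₀ (by rw [← ha, h0]; ring)
      have hb0 : b ≠ 0 := fun h0 => h1 (by
        have : -w (l₀ + 1) = 0 := by rw [← hb, h0]; ring
        exact neg_eq_zero.mp this)
      have he0 : e ≠ 0 := fun h0 => h2 (by
        have : -w (l₀ + 2) = 0 := by rw [← he, h0]; ring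
        exact neg_eq_zero.mp this)
      set P : ℂ[X] := C a * z l₀ + C b * z (l₀ + 1) with hP
      set P' : ℂ[X] := C a * z l₀ - C b * z (l₀ + 1) with hP'
      set R : ℂ[X] := C e * z (l₀ + 2) with hR
      have hconic : P * P' = R ^ 2 := by
        have e1 : P * P' = C (a ^ 2) * z l₀ ^ 2 - C (b ^ 2) * z (l₀ + 1) ^ 2 := by
          simp only [hP, hP', C_pow]; ring
        have e2 : R ^ 2 = C (e ^ 2) * z (l₀ + 2) ^ 2 := by simp only [hR, C_pow]; ring
        rw [e1, e2, ha, hb, he, C_neg, C_neg]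
        linear_combination hrel
      obtain ⟨D, M, N, u, u', w', hPD, hP'D, hRD⟩ := stub_conicParam P P' R hconic
      by_cases hu : u = 0
      · -- `P = 0`: `z_{l₀} = -(b/a) z_{l₀+1}`
        have hP0 : P = 0 := by rw [hPD, hu, C_0, zero_mul]
        refine hred l₀ (-b / a) 0 ?_
        have : C a * z l₀ = C (-b) * z (l₀ + 1) := by
          rw [C_neg, neg_mul]; exact eq_neg_of_add_eq_zero_left hP0
        rw [C_0, zero_mul, add_zero]; exact sft_solve ha0 this
      by_cases hu' : u' = 0
      · have hP'0 : P' = 0 := by rw [hP'D, hu', C_0, zero_mul]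
        refine hred l₀ (b / a) 0 ?_
        have : C a * z l₀ = C b * z (l₀ + 1) := sub_eq_zero.mp hP'0
        rw [C_0, zero_mul, add_zero]; exact sft_solve ha0 this
      by_cases hw' : w' = 0
      · -- `R = 0`: `z_{l₀+2} = 0`, read from `m = l₀ + 2`: `z_{l₀+2} = 0·z_{l₀+3} + 0·z_{l₀+4}`
        have hR0 : z (l₀ + 2) = 0 := by
          have : R = 0 := by rw [hRD, hw', C_0, zero_mul]
          rw [hR] at this
          rcases mul_eq_zero.mp this with h | h
          · exact absurd (C_eq_zero.mp h) he0
          · exact h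
        exact hred (l₀ + 2) 0 0 (by rw [hR0, C_0, zero_mul, zero_mul, add_zero])
      have hDM2 : D * M ^ 2 = C u⁻¹ * P := by
        rw [hPD]; simp only [← mul_assoc, ← C_mul, inv_mul_cancel₀ hu, C_1, one_mul]
      have hDN2 : D * N ^ 2 = C u'⁻¹ * P' := by
        rw [hP'D]; simp only [← mul_assoc, ← C_mul, inv_mul_cancel₀ hu', C_1, one_mul]
      have hDMN : D * (M * N) = C w'⁻¹ * R := by
        rw [hRD]; simp only [← mul_assoc, ← C_mul, inv_mul_cancel₀ hw', C_1, one_mul]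
      have hDM2U : (D * M ^ 2).support ⊆ U := by
        rw [hDM2]
        refine (sft_support_C_mul_subset _ _).trans ?_
        exact support_add.trans (Finset.union_subset ((sft_support_C_mul_subset _ _).trans (hzU _))
          ((sft_support_C_mul_subset _ _).trans (hzU _)))
      have hDN2U : (D * N ^ 2).support ⊆ U := by
        rw [hDN2]
        refine (sft_support_C_mul_subset _ _).trans ?_
        exact (tds_support_sub _ _).trans (Finset.union_subset ((sft_support_C_mul_subset _ _).trans (hzU _))
          ((sft_support_C_mul_subset _ _).trans (hzU _)))
      have hDMNU : (D * (M * N)).support ⊆ U := by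
        rw [hDMN]; exact (sft_support_C_mul_subset _ _).trans ((sft_support_C_mul_subset _ _).trans (hzU _))
      have h2a : (2 : ℂ) * a ≠ 0 := mul_ne_zero two_ne_zero ha0
      have h2b : (2 : ℂ) * b ≠ 0 := mul_ne_zero two_ne_zero hb0
      have hz0 : z l₀ = C (u / (2 * a)) * (D * M ^ 2) + C (u' / (2 * a)) * (D * N ^ 2) := by
        have e1 : C (2 * a) * z l₀ = P + P' := by simp only [hP, hP', C_mul, map_ofNat]; ring
        rw [hDM2, hDN2]
        simp only [← mul_assoc, ← C_mul]
        have e2 : u / (2 * a) * u⁻¹ = (2 * a)⁻¹ := by field_simp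
        have e3 : u' / (2 * a) * u'⁻¹ = (2 * a)⁻¹ := by field_simp
        rw [e2, e3, ← mul_add, ← e1, ← mul_assoc, ← C_mul, inv_mul_cancel₀ h2a, C_1, one_mul]
      have hz1 : z (l₀ + 1) = C (u / (2 * b)) * (D * M ^ 2) + C (-(u' / (2 * b))) * (D * N ^ 2) := by
        have e1 : C (2 * b) * z (l₀ + 1) = P - P' := by simp only [hP, hP', C_mul, map_ofNat]; ring
        rw [hDM2, hDN2]
        simp only [← mul_assoc, ← C_mul]
        have e2 : u / (2 * b) * u⁻¹ = (2 * b)⁻¹ := by field_simp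
        have e3 : -(u' / (2 * b)) * u'⁻¹ = -(2 * b)⁻¹ := by field_simp
        rw [e2, e3, C_neg, neg_mul, ← sub_eq_add_neg, ← mul_sub, ← e1, ← mul_assoc, ← C_mul,
          inv_mul_cancel₀ h2b, C_1, one_mul]
      have hz2 : z (l₀ + 2) = C (w' / e) * (D * (M * N)) := by
        rw [hDMN]
        simp only [← mul_assoc, ← C_mul]
        have e2 : w' / e * w'⁻¹ = e⁻¹ := by field_simp
        rw [e2, hR, ← mul_assoc, ← C_mul, inv_mul_cancel₀ he0, C_1, one_mul]
      have hgform : ∀ j, ∃ κ μ lam : ℂ, g j = D * (C κ * M ^ 2 + C μ * (M * N) + C lam * N ^ 2) := by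
        intro j
        refine ⟨E⁻¹ j l₀ * (u / (2 * a)) + E⁻¹ j (l₀ + 1) * (u / (2 * b)),
          E⁻¹ j (l₀ + 2) * (w' / e),
          E⁻¹ j l₀ * (u' / (2 * a)) + E⁻¹ j (l₀ + 1) * (-(u' / (2 * b))), ?_⟩
        rw [hginv j, sft_sum_rotate _ l₀, hz0, hz1, hz2]
        simp only [C_add, C_mul, C_neg]
        ring
      choose κ μ lam hgj using hgform
      set φ0 : ℂ := ∑ i, c i * lam i ^ 2 with hφ0
      set φ1 : ℂ := ∑ i, c i * (2 * μ i * lam i) with hφ1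
      set φ2 : ℂ := ∑ i, c i * (μ i ^ 2 + 2 * κ i * lam i) with hφ2
      set φ3 : ℂ := ∑ i, c i * (2 * κ i * μ i) with hφ3
      set φ4 : ℂ := ∑ i, c i * κ i ^ 2 with hφ4
      have hF5 : (∑ i, C (c i) * g i ^ 2) = D ^ 2 * (C φ0 * (M ^ 0 * N ^ 4) + C φ1 * (M ^ 1 * N ^ 3)
          + C φ2 * (M ^ 2 * N ^ 2) + C φ3 * (M ^ 3 * N ^ 1) + C φ4 * (M ^ 4 * N ^ 0)) := by
        have e1 : ∀ i, C (c i) * g i ^ 2 = D ^ 2 * (C (c i * lam i ^ 2) * (M ^ 0 * N ^ 4))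
            + D ^ 2 * (C (c i * (2 * μ i * lam i)) * (M ^ 1 * N ^ 3))
            + D ^ 2 * (C (c i * (μ i ^ 2 + 2 * κ i * lam i)) * (M ^ 2 * N ^ 2))
            + D ^ 2 * (C (c i * (2 * κ i * μ i)) * (M ^ 3 * N ^ 1))
            + D ^ 2 * (C (c i * κ i ^ 2) * (M ^ 4 * N ^ 0)) := fun i => by
          rw [hgj i]; simp only [C_mul, C_add, C_pow, map_ofNat]; ring
        rw [Finset.sum_congr rfl fun i _ => e1 i]
        simp only [Finset.sum_add_distrib, ← Finset.mul_sum, ← Finset.sum_mul, ← map_sum]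
        ring
      set φ : Fin 5 → ℂ := ![φ0, φ1, φ2, φ3, φ4] with hφ
      have hFquartic : (∑ i, C (c i) * g i ^ 2)
          = D ^ 2 * ∑ k : Fin 5, C (φ k) * (M ^ (k : ℕ) * N ^ (4 - (k : ℕ))) := by
        rw [hF5, Fin.sum_univ_five]
        simp [hφ]
      obtain ⟨α, β, hsplit⟩ := stub_binaryQuarticSplit φ M N
      set A : ℂ[X] := D * ∑ k : Fin 3, C (α k) * (M ^ (k : ℕ) * N ^ (2 - (k : ℕ))) with hA
      set B : ℂ[X] := D * ∑ k : Fin 3, C (β k) * (M ^ (k : ℕ) * N ^ (2 - (k : ℕ))) with hB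
      have hqfU : ∀ (γ : Fin 3 → ℂ), (D * ∑ k : Fin 3, C (γ k) * (M ^ (k : ℕ) * N ^ (2 - (k : ℕ)))).support ⊆ U := by
        intro γ
        have e1 : D * ∑ k : Fin 3, C (γ k) * (M ^ (k : ℕ) * N ^ (2 - (k : ℕ)))
            = C (γ 0) * (D * N ^ 2) + C (γ 1) * (D * (M * N)) + C (γ 2) * (D * M ^ 2) := by
          rw [Fin.sum_univ_three]; simp; ring
        rw [e1]
        exact support_add.trans (Finset.union_subset (support_add.trans (Finset.union_subset
          ((sft_support_C_mul_subset _ _).trans hDN2U) ((sft_support_C_mul_subset _ _).trans hDMNU)))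
          ((sft_support_C_mul_subset _ _).trans hDM2U))
      refine sft_no_split p hp U S hUS hS A B (hqfU α) (hqfU β) ?_
      rw [← hrep, hFquartic, hsplit, hA, hB]; ring

/-- **Corollary: linear independence at fan-in 3.** -/
theorem linearIndependent_three (p : ℕ) [Fact p.Prime] (hp : 257 ≤ p) (c : Fin 3 → ℂ) (g : Fin 3 → ℂ[X])
    (hS : (∑ i, (g i).support.card) ^ 4 ≤ p ^ 3)
    (hrep : (∑ i, C (c i) * g i ^ 2) = ∑ m ∈ Finset.range p, C ((legendreSym p m : ℤ) : ℂ) * X ^ m)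
    (α : Fin 3 → ℂ) (hα : (∑ j, C (α j) * g j) = 0) : α = 0 := by
  have hsym : (Matrix.of fun j j' => α j * α j').IsSymm := by
    ext j j'; simp [mul_comm]
  have hν : (∑ j, ∑ j', C ((Matrix.of fun j j' => α j * α j') j j') * (g j * g j')) = 0 := by
    have e : (∑ j, ∑ j', C ((Matrix.of fun j j' => α j * α j') j j') * (g j * g j'))
        = (∑ j, C (α j) * g j) * (∑ j, C (α j) * g j) := by
      rw [Finset.sum_mul_sum]
      refine Finset.sum_congr rfl fun j _ => Finset.sum_congr rfl fun j' _ => ?_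
      simp only [Matrix.of_apply, C_mul]; ring
    rw [e, hα, zero_mul]
  have h0 := syzygyFree_three p hp c g hS hrep _ hsym hν
  funext j
  have := congrArg (fun M : Matrix (Fin 3) (Fin 3) ℂ => M j j) h0
  simp only [Matrix.of_apply, Matrix.zero_apply, mul_self_eq_zero] at this
  exact this

end Summit.ValiantsHypothesis.ValiantsHypothesis.Theorems.SublinearShadowSketch
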